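import Summits.BirchSwinnertonDyer.BirchSwinnertonDyer.Theses.TameQuarticManinParity
import Literature.NumberTheory.EllipticCurves.ManinConstantModularDegree
import Literature.NumberTheory.DiophantineGeometry.ConductorFactorizationProofs
import HarnessLib

/-!
# Route `TameQuarticManinParity` — the ČNS halves of the (t′)@3 Manin `3`-unit, GRANTED the ČNS fact

HONEST FRAMING. Items stmt-BirchSwinnertonDyer-24499 (`TprimeIrrManinUnitOfDegreePrimeToThree`) and
stmt-BirchSwinnertonDyer-24628 (`TprimeRedManinUnitOfDegreePrimeToThree`) are the rows of the tame quartic class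
(t′) at `3` whose conductor-level optimal datum has modular degree prime to `3`. They are CONDITIONAL-closed here:
each follows from the cite-only named fact
`Literature.NumberTheory.EllipticCurves.ModularForms.cesnaviciusNeururerSaha_padicVal_maninConstant_le_modularDegree`
(Česnavičius–Neururer–Saha 2023 Thm 1.2, row «0 otherwise»), taken as a HYPOTHESIS `h`. The only content proved
here is the bookkeeping «(t′) at `3` ⇒ conductor exponent `f₃ = 2` ⇒ `3³ ∤ N`», which voids ČNS's exceptional clause
at `3`, and the call to the tree's `not_three_dvd_maninConstant_of_not_dvd_modularDegree`. These are NOT by-name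
closers (the items' own signatures are unconditional); unconditional closure = porting ČNS (XL). Planner sketches:
bsd-idea-3 g3, tqmp/Sketch8.lean / Sketch9.lean (`…_of_cns`). BSD is not proved by any of this.
-/

-- D-0017: single-problem summit, so `Summit.BirchSwinnertonDyer.BirchSwinnertonDyer.…` repeats a namespace BY DESIGN.
set_option linter.dupNamespace false

namespace Summit.BirchSwinnertonDyer.BirchSwinnertonDyer.Theorems.TameQuarticManinParity

open Summit.BirchSwinnertonDyer.BirchSwinnertonDyer.Theses.TameQuarticManinParity
open Literature.NumberTheory.EllipticCurves.ModularForms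

/-- On the census cell (t′) at `3` (`SubTprime W 3`: in particular conductor exponent `f₃ = 2`) the conductor is
not divisible by `3³`: `(W.conductorNorm ℤ).factorization 3 = W.conductorExponent (placeOf 3) = condExp W 3 = 2`
(`WeierstrassCurve.factorization_conductorNorm_holds`). Bookkeeping only. -/
theorem not_pow_three_dvd_conductorNorm_of_subTprime (W : WeierstrassCurve ℚ) [W.IsElliptic]
    [W.IsGloballyMinimal] [NeZero (W.conductorNorm ℤ)]
    (ht : Summit.BirchSwinnertonDyer.Rank1Residual.Additive.SubTprime W 3) :
    ¬ 3 ^ 3 ∣ W.conductorNorm ℤ := by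
  have h2 : Summit.BirchSwinnertonDyer.Rank1Residual.Additive.condExp W 3 = 2 := ht.2.1
  have hf : (W.conductorNorm ℤ).factorization (Rat.HeightOneSpectrum.natGenerator
      (Summit.BirchSwinnertonDyer.Rank1Residual.Additive.placeOf 3)) =
      W.conductorExponent (Summit.BirchSwinnertonDyer.Rank1Residual.Additive.placeOf 3) :=
    WeierstrassCurve.factorization_conductorNorm_holds W _
  have hgen : Rat.HeightOneSpectrum.natGenerator
      (Summit.BirchSwinnertonDyer.Rank1Residual.Additive.placeOf 3) = 3 :=
    congrArg Subtype.val ((Rat.HeightOneSpectrum.primesEquiv (R := ℤ)).apply_symm_apply ⟨3, Nat.prime_three⟩)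
  intro hdvd
  have hle : 3 ≤ (W.conductorNorm ℤ).factorization 3 :=
    (Nat.prime_three.pow_dvd_iff_le_factorization (NeZero.ne _)).mp hdvd
  rw [hgen] at hf
  unfold Summit.BirchSwinnertonDyer.Rank1Residual.Additive.condExp at h2
  rw [hf, h2] at hle
  omega

/-- **Item stmt-BirchSwinnertonDyer-24499 GRANTED ČNS** (conditional; the ČNS fact is the hypothesis `h`): on the
irreducible (t′)@3 rows, an optimal conductor-level datum `D` with `3 ∤ deg φ` has `3 ∤ c(D)` — ČNS Thm 1.2 gives
`v₃(c) ≤ v₃(deg φ) = 0` since `3³ ∤ N` on (t′) (`not_pow_three_dvd_conductorNorm_of_subTprime`). The hypotheses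
`¬ HasCM`, `Addv`, irreducibility, lattice clause and degree-minimality are carried verbatim from the item and not
used. Planner sketch tqmp/Sketch8.lean `tprimeIrrManinUnitOfDegreePrimeToThree_of_cns`. -/
theorem tprimeIrrManinUnitOfDegreePrimeToThree_of_cns
    (h : cesnaviciusNeururerSaha_padicVal_maninConstant_le_modularDegree) :
    TprimeIrrManinUnitOfDegreePrimeToThree := by
  unfold TprimeIrrManinUnitOfDegreePrimeToThree
  intro W _ _ _ _ _ ht _ D _ _ hdeg
  exact not_three_dvd_maninConstant_of_not_dvd_modularDegree h W D
    (Or.inl (not_pow_three_dvd_conductorNorm_of_subTprime W ht)) hdeg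

/-- **Item stmt-BirchSwinnertonDyer-24628 GRANTED ČNS** (conditional; the ČNS fact is the hypothesis `h`): on the
REDUCIBLE (t′)@3 rows, an optimal conductor-level datum `D` with `3 ∤ deg φ` has `3 ∤ c(D)` — same argument, ČNS
uses no irreducibility. Planner sketch tqmp/Sketch9.lean `tprimeRedManinUnitOfDegreePrimeToThree_of_cns`. -/
theorem tprimeRedManinUnitOfDegreePrimeToThree_of_cns
    (h : cesnaviciusNeururerSaha_padicVal_maninConstant_le_modularDegree) :
    TprimeRedManinUnitOfDegreePrimeToThree := by
  unfold TprimeRedManinUnitOfDegreePrimeToThree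
  intro W _ _ _ _ _ ht _ D _ _ hdeg
  exact not_three_dvd_maninConstant_of_not_dvd_modularDegree h W D
    (Or.inl (not_pow_three_dvd_conductorNorm_of_subTprime W ht)) hdeg

end Summit.BirchSwinnertonDyer.BirchSwinnertonDyer.Theorems.TameQuarticManinParity
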